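import Summits.ResolutionOfSingularities.ResolutionOfSingularities.Theorems.EquisingularLiftEquisingularLiftNatPrefixSupplierDefs
import Summits.ResolutionOfSingularities.ResolutionOfSingularities.Theorems.EquisingularLiftEquisingularLiftNatERoundLicence
import HarnessLib

/-!
# [OURS · L1 W4.5(b) · EL♮(3) · WIDTH TABLE D13 «(P-ram-Γ) / E-ROUND», supplier part 4] THE SLOT CAP `TCPlus.hpramGamma_supplier : HPRamGammaSupplier k 3`
# + THE ENGINE-SIDE PIECES OF STAGE 2: the ram's exceptional divisor as HOST MODEL (`TCPlus.ramPlane_hostModel`) and upstairs disjointness from traces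

res-L1-w45b-stub-2 g20 (D13 supplier pen; desk R74b (d) / R74c (2)–(3) / R75 (v) / R76 (iii)).  OURS; NOT a statement of any manuscript ([Hironaka2017]
is a candidate under adjudication, nothing of it is asserted); AI-written, weaker than expert review.  No `sorry`; standard axioms; DEF-FREE;
hypothesis-free.  `--supports stmt-ResolutionOfSingularities-20148 --as helper`, counted 0.  EL♮(3) is NOT proved; resolution of singularities in
positive characteristic is NOT proved anywhere in this tree.

WHAT.
* `disjoint_support_of_forall_ne_closedPoint`, `disjoint_support_of_disjoint_support_comap` — supports of two ideal sheaves on a scheme universally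
  closed over `Spec O` that do not meet over the closed point (equivalently: whose TRACES on the special fibre are disjoint) do not meet at all
  (✓ `disjoint_support_of_inter_fibre_eq_singleton`'s argument); the upstairs input `hdj` of ✓ `Tower.exc₄_transport_away` for a member `F ∌ pt`
  through the E-round (`supp 𝓘 ⊆ υ₂⁻¹ pt`).
* ★ `TCPlus.ramPlane_hostModel` — after ✓ `fatPointStep_model` (ram centre `C₁`, `τ = Bl_{C₁}`, new `Ch`-stage with model square `j₂`,
  `j₂ ≫ τ = υ₂ ≫ j`): `𝓔 := C₁·𝒪_{X″}` (the exceptional divisor `E_{L′} ≅ ℙ²_{O′}`) has the E-round licence's five host antecedents, is off the generic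
  point of `Y`, has trace `𝓔·𝒪_{F₂} = J·𝒪_{F₂}` and satisfies (Γ2) for every customer `𝓘` — the package res-L1-w45b-stub-4's PΓ tail-closure case feeds
  to ★ `ERound.eRoundLift` when it composes stage 2 itself (keeping the centres for the member transports), exactly as ★★ `TCPlus.pRamGamma_step` does
  internally.
* `TCPlus.hpramGamma_supplier (k) : HPRamGammaSupplier k 3 := TCPlus.pRamGamma_step k` — the 9th slot (res-type-027, ✓ p710786) inhabited with
  zero glue.
[cite: Liu2002, Thm. 8.1.19] [cite: StacksProject, Tag 01K0] [folklore; pure assembly otherwise]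
-/

set_option linter.dupNamespace false -- mandated namespace `Summit.<Summit>.<Problem>` of this single-conjunct summit
set_option linter.overlappingInstances false -- signatures carry `[IsDomain O] [IsDiscreteValuationRing O]`

noncomputable section

open CategoryTheory CategoryTheory.Limits AlgebraicGeometry TopologicalSpace Topology IsLocalRing
open Literature.AlgebraicGeometry.Resolution
open AlgebraicGeometry.Scheme.IdealSheafData
open Summit.ResolutionOfSingularities.ResolutionOfSingularities.Theses.EquisingularLift.Split
open Summit.ResolutionOfSingularities.ResolutionOfSingularities.Cruxes.EquisingularLift.StrataSplit

namespace Summit.ResolutionOfSingularities.ResolutionOfSingularities.Cruxes.EquisingularLiftNat.Sections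

/-! ## Disjointness upstairs from disjointness of traces -/

/-- **Supports that do not meet on the special fibre do not meet at all** (✓ `disjoint_support_of_inter_fibre_eq_singleton`, (E5), with the point
replaced by any trace condition): over `Spec O`, `O` local, `r : X → Spec O` universally closed, if no point of `supp I ∩ supp C` lies over the closed
point then `supp I ∩ supp C = ∅` — its image in `Spec O` is closed, and a non-empty closed subset of `Spec O` contains the closed point.  In a model
square `j : G ⟶ X` (`range j` = the special fibre) the hypothesis reads `Disjoint (supp I·𝒪_G) (supp C·𝒪_G)`; this is the upstairs disjointness the
tower's AWAY transport (✓ `Tower.exc₄_transport_away`) needs for a member `F` through the E-round (`supp 𝓘 ⊆ υ₂⁻¹ pt`, `pt ∉ F`).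
[folklore; cite: StacksProject, Tag 01K0] [OURS · D13 supplier, for the engine's stage-2 transports] -/
theorem disjoint_support_of_forall_ne_closedPoint {O : Type} [CommRing O] [IsLocalRing O] {X : Scheme.{0}}
    (r : X ⟶ Spec (.of O)) [UniversallyClosed r] (C I : X.IdealSheafData)
    (h : ∀ x ∈ (I.support : Set X), x ∈ (C.support : Set X) → r x ≠ IsLocalRing.closedPoint O) :
    Disjoint (I.support : Set X) (C.support : Set X) := by
  -- adapted from ✓ `disjoint_support_of_inter_fibre_eq_singleton` (…NatBlowupDisjointTransport)
  rw [Set.disjoint_iff_inter_eq_empty]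
  by_contra hne
  have hcl : IsClosed (r '' ((I.support : Set X) ∩ (C.support : Set X))) :=
    r.isClosedMap _ (I.support.isClosed.inter C.support.isClosed)
  have hmem : IsLocalRing.closedPoint O ∈ r '' ((I.support : Set X) ∩ (C.support : Set X)) := by
    by_contra hnot
    have hU : (⟨(r '' ((I.support : Set X) ∩ (C.support : Set X)))ᶜ, hcl.isOpen_compl⟩ :
        Opens (PrimeSpectrum O)) = ⊤ :=
      (IsLocalRing.closed_point_mem_iff).mp hnot
    have h1 := congrArg (fun U : Opens (PrimeSpectrum O) => ((U : Set (PrimeSpectrum O)))ᶜ) hU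
    simp only [Opens.coe_mk, compl_compl, Opens.coe_top, Set.compl_univ] at h1
    exact hne (Set.image_eq_empty.mp h1)
  obtain ⟨c, ⟨hcI, hcC⟩, hc⟩ := hmem
  exact h c hcI hcC hc

/-- **Model-square form**: if the TRACES `I·𝒪_G` and `C·𝒪_G` have disjoint supports then `supp I ∩ supp C = ∅` (every point over the closed point of
`O` is in the range of `j`). [folklore] [OURS · D13 supplier, for the engine's stage-2 transports] -/
theorem disjoint_support_of_disjoint_support_comap {O : Type} [CommRing O] [IsLocalRing O] {k : Type} [Field k] (θ : O →+* k)
    (hθ : Function.Surjective θ) {X G : Scheme.{0}} (r : X ⟶ Spec (.of O)) [UniversallyClosed r] (j : G ⟶ X) (t : G ⟶ Spec (.of k))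
    (hsq : IsPullback j t r (Spec.map (CommRingCat.ofHom θ))) (C I : X.IdealSheafData)
    (h : Disjoint ((I.comap j).support : Set G) ((C.comap j).support : Set G)) :
    Disjoint (I.support : Set X) (C.support : Set X) := by
  refine disjoint_support_of_forall_ne_closedPoint r C I fun x hxI hxC hx => ?_
  have hxr : x ∈ Set.range j := by
    rw [range_eq_preimage_of_isPullback hsq, range_specMap_of_surjective_of_field θ hθ]; exact hx
  obtain ⟨z, rfl⟩ := hxr
  have hzI : z ∈ ((I.comap j).support : Set G) := by rw [Scheme.IdealSheafData.support_comap]; exact hxI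
  have hzC : z ∈ ((C.comap j).support : Set G) := by rw [Scheme.IdealSheafData.support_comap]; exact hxC
  exact Set.disjoint_left.mp h hzI hzC

/-! ## The host model of the ram's fresh plane -/

/-- ★ **THE RAM'S EXCEPTIONAL DIVISOR IS A HOST MODEL FOR ITS FRESH PLANE** (for the engine's own two-stage composition, res-L1-w45b-stub-4's PΓ
tail-closure case, which keeps the centres in hand): after ✓ `fatPointStep_model` — ram centre `C₁` on the `Ch`-stage `X′` (regular, `O`-flat, off the
generic point of `Y`, trace `C₁·𝒪_{F₁} = J`), `τ = Bl_{C₁}`, the new `Ch`-stage `X″` with model square `(j₂, t₂)`, `j₂ ≫ τ = υ₂ ≫ j` — the ideal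
`𝓔 := C₁·𝒪_{X″}` of the exceptional divisor `E_{L′}` satisfies the E-round licence's five host antecedents (stalkwise principal, `≠ ⊥`, `V(𝓔)` regular,
`O`-flat, proper), is off the generic point of `Y`, has TRACE `𝓔·𝒪_{F₂} = J·𝒪_{F₂}` (the e-fold plane), and (Γ2) holds for every customer `𝓘 ⊇ J·𝒪_{F₂}`.
[cite: Liu2002, Thm. 8.1.19] [OURS · D13 supplier; pure assembly of ✓ `pointPlane_model`'s lemmas + T-DIM] -/
theorem TCPlus.ramPlane_hostModel (O : Type) [CommRing O] [IsDomain O] [IsDiscreteValuationRing O] (k : Type) [Field k]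
    (θ : O →+* k) (hθ : Function.Surjective θ) {P : Scheme.{0}} [IsIntegral P] (q : P ⟶ Spec (.of O)) [SmoothOfRelativeDimension 3 q]
    {Y : Set P} (hYirr : IsIrreducible Y) (hYcl : IsClosed Y)
    {X' X'' : Scheme.{0}} [IsLocallyNoetherian X'] [IsIntegral X''] [IsLocallyNoetherian X''] {σ' : X' ⟶ P} (hX'reg : Scheme.IsRegular X')
    {F₁ F₂ : Scheme.{0}} {j : F₁ ⟶ X'} {J : F₁.IdealSheafData} {υ₂ : F₂ ⟶ F₁}
    {C₁ : X'.IdealSheafData} {τ : X'' ⟶ X'} (hτ : IsBlowup τ C₁) (hC₁j : C₁.comap j = J) (hC₁reg : Scheme.IsRegular C₁.subscheme)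
    (hC₁fl : Flat (C₁.subschemeι ≫ σ' ≫ q)) (hC₁off : σ' '' (C₁.support : Set X') ⊆ {p : P | ¬ IsGenericPoint p Y})
    {S'' : Set X''} (hch'' : Chain P Y X'' (τ ≫ σ') S'') [IsProper ((τ ≫ σ') ≫ q)]
    (j₂ : F₂ ⟶ X'') (t₂ : F₂ ⟶ Spec (.of k)) (hsq₂ : IsPullback j₂ t₂ ((τ ≫ σ') ≫ q) (Spec.map (CommRingCat.ofHom θ)))
    (hcomm : j₂ ≫ τ = υ₂ ≫ j) :
    (∀ x : X'', (stalkIdeal (C₁.comap τ) x).IsPrincipal) ∧ C₁.comap τ ≠ ⊥ ∧ Scheme.IsRegular (C₁.comap τ).subscheme ∧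
      Flat ((C₁.comap τ).subschemeι ≫ (τ ≫ σ') ≫ q) ∧ IsProper ((C₁.comap τ).subschemeι ≫ (τ ≫ σ') ≫ q) ∧
      (τ ≫ σ') '' ((C₁.comap τ).support : Set X'') ⊆ {p : P | ¬ IsGenericPoint p Y} ∧
      (C₁.comap τ).comap j₂ = J.comap υ₂ ∧
      ∀ (𝓘 : F₂.IdealSheafData) (i : 𝓘.subscheme ⟶ (J.comap υ₂).subscheme), i ≫ (J.comap υ₂).subschemeι = 𝓘.subschemeι →
        ∀ z : ↥𝓘.subscheme, IsClosed ({z} : Set ↥𝓘.subscheme) →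
          ringKrullDim ((J.comap υ₂).subscheme.presheaf.stalk (i z)) = ((2 : ℕ) : WithBot ℕ∞) := by
  set 𝓔 : X''.IdealSheafData := C₁.comap τ with h𝓔def
  have hEpr : ∀ x : X'', (stalkIdeal 𝓔 x).IsPrincipal := isPrincipal_stalkIdeal_comap_of_isBlowup C₁ hτ
  have h𝓔reg : Scheme.IsRegular 𝓔.subscheme := hτ.isRegular_subscheme_comap hX'reg hC₁reg
  have h𝓔fl0 := flat_exceptional_of_isBlowup_regularCentre O X' X'' (σ' ≫ q) C₁ hX'reg hC₁reg hC₁fl τ hτ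
  have h𝓔flat : Flat (𝓔.subschemeι ≫ (τ ≫ σ') ≫ q) := by simpa only [Category.assoc] using h𝓔fl0
  have h𝓔prop : IsProper (𝓔.subschemeι ≫ (τ ≫ σ') ≫ q) := inferInstance
  have hEoff : (τ ≫ σ') '' (𝓔.support : Set X'') ⊆ {p : P | ¬ IsGenericPoint p Y} := image_support_comap_subset C₁ τ σ' hC₁off
  obtain ⟨ξ, hξ⟩ : ∃ ξ : P, IsGenericPoint ξ Y := QuasiSober.sober hYirr hYcl
  have h𝓔0 : 𝓔 ≠ ⊥ := by
    obtain ⟨ξ', hfib', -⟩ := Chain.fibre hch'' hξ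
    intro h0
    have hmem : ξ' ∈ (𝓔.support : Set X'') := by rw [h0, Scheme.IdealSheafData.support_bot]; trivial
    have hgen : (τ ≫ σ') ξ' = ξ := by
      have : ξ' ∈ (τ ≫ σ') ⁻¹' {ξ} := by rw [hfib']; exact Set.mem_singleton ξ'
      exact this
    exact hEoff ⟨ξ', hmem, rfl⟩ (hgen ▸ hξ)
  have h𝓙 : 𝓔.comap j₂ = J.comap υ₂ := by
    rw [h𝓔def, ← Scheme.IdealSheafData.comap_comp, hcomm, Scheme.IdealSheafData.comap_comp, hC₁j]
  haveI : Flat (𝓔.subschemeι ≫ (τ ≫ σ') ≫ q) := h𝓔flat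
  refine ⟨hEpr, h𝓔0, h𝓔reg, h𝓔flat, h𝓔prop, hEoff, h𝓙, ?_⟩
  intro 𝓘 i hi z hz
  refine ringKrullDim_trace_stalk_eq_two_of_model O k θ hθ q hξ hch'' j₂ t₂ hsq₂ 𝓔 hEpr h𝓔0 h𝓙 (i z) ?_
  have hzF : IsClosed ({𝓘.subschemeι z} : Set F₂) := by
    have h1 := (𝓘.subschemeι.isClosedEmbedding.isClosedMap) _ hz
    rwa [Set.image_singleton] at h1
  have h1 : ({i z} : Set ↥(J.comap υ₂).subscheme) = (J.comap υ₂).subschemeι ⁻¹' {𝓘.subschemeι z} := by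
    ext s'
    simp only [Set.mem_singleton_iff, Set.mem_preimage]
    constructor
    · intro h; rw [h, ← Scheme.Hom.comp_apply, hi]
    · intro h
      apply (J.comap υ₂).subschemeι.isClosedEmbedding.injective
      rw [h, ← Scheme.Hom.comp_apply, hi]
  rw [h1]; exact hzF.preimage (J.comap υ₂).subschemeι.continuous

/-! ## The slot cap -/

/-- **HPRAM-Γ at `n = 3`: the hostless «ramified point step + plane round in its fresh exceptional plane» supplier of the D13 engine** — ✓ `TCPlus.pRamGamma_step`
in the slot currency `HPRamGammaSupplier k 3` (zero glue). [OURS · L1 W4.5b · D13 supplier cap; NOT a statement of the manuscript; EL♮(3) NOT proved] -/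
theorem TCPlus.hpramGamma_supplier (k : Type) [Field k] : HPRamGammaSupplier k 3 :=
  TCPlus.pRamGamma_step k

end Summit.ResolutionOfSingularities.ResolutionOfSingularities.Cruxes.EquisingularLiftNat.Sections

end
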